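import Summits.BirchSwinnertonDyer.Rank1Residual.X10.SecondDescentOneLineRankOne
import HarnessLib

/-!
# R1SHA9 records, batch B part 04: RANK-ONE Ш-cells at `p = 3` (`#Ш_an = 9`, surjective `ρ̄_{E,3}`; book cells (3, X4) / (3, X11b) / (3, X7)) — `BSD(E,3)` from bsd.S18 (displayed), GZK, the two-engine descent count `#Sel³(E/ℚ) = 27` and ONE EMPTY second `3`-descent (cell `b2b-bsdres`, unit `b2b-bsdres-x10`, gen 57)

HONEST FRAMING (run/shared/lean/b2b/bsd-rank1-residual/, verbatim in every file): the goal of the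
cell is to DELETE the COMBINATION-SHAPED residual classes of the Birch–Swinnerton-Dyer formula for
ALL analytic-rank `≤ 1` elliptic curves over `ℚ` — "full BSD formula for every rank `≤ 1` curve in
class `C`" assembled STRICTLY from published theorems — so that the rank-`≤ 1` remainder becomes
exactly the CONSTRUCTION-SHAPED classes, which are TYPED (missing-input `Prop`s), NOT attempted.
This is not "finishing BSD". Theorems only (no definition, no named fact); NOTHING IS BOOKED here;
no class label changes (X4 / X7 / X11b keep their marks; their class-level typed inputs are untouched). Per pair.

**What this file is.** The RANK-ONE one-line door `X10/SecondDescentOneLineRankOne.lean` (p757852, x10 GEN 57;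
door `X10.bsdp_three_rankOne_of_card_selmerThree_of_oneNonDivisible` = the torsion-agnostic one-line door p696472 with
`r_an = 0` relaxed to `r_an ≤ 1` and `#Ш[3] ≤ 9` derived from the descent count by the tree's PROVED exact sequence count
`WeierstrassCurve.natCard_selmerGroup_eq`, AEC X.4.2(a)): at a curve `E/ℚ` of analytic rank `1` (GZK `hGZK`: rank `1`, `Ш`
finite) with `#Sel^(3)(E/ℚ) = 27 = 3^(1+2)` (so `#Ш[3] ≤ 9`, any torsion), ONE non-zero class of `Ш[3]` NOT divisible by `3`, and
`ord₃ #Ш_an = 2`, the Cassels–Tate pairing fact **bsd.S18** (Cassels 1962 = Silverman AEC X.4.14; tree named fact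
`WeierstrassCurve.exists_casselsTate_pairing`, DISPLAYED as the binder `hCT` exactly as on every C9 / C9-RED / D3 record) gives
`#Ш[3] = 9` (squareness from `1 < #Ш[3] ≤ 9` under the alternating non-degenerate pairing) and `Ш[9] = Ш[3]` (the orthogonal of
`Ш[3]` is `3Ш`, so the non-divisible class has a Gram partner; `X10.sq_nsmul_stable_of_gram`), hence `#Ш(E/ℚ)(3) = 9 = 3^(ord₃ #Ш_an)`,
i.e. Miller's `BSD(E,3)`. The two displayed arithmetic inputs are produced by TWO ENGINES WRITTEN APART, per input:
* `hcard : #Sel³(E/ℚ) = 27` — EXACT `3`-descent (Schaefer–Stoll): engine 1 = x11b `desc3lib.gp` (octic flex-point algebra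
  `A = ℚ(T)`, `A(S,3)` from a CERTIFIED class group — `bnfcertify(A,1) = 1` — and 3-saturated `S`-units, `H¹(ℚ,E[3];S)` cut by the
  norm / `w₁` conditions, local images REACHED at every `v ∈ S`; front `front_octic.gp`, x10 GEN 48 node-sampler patch of
  `localimage` only) ‖ engine 2 = x10b `desc3full_e2.py` (cypari2; independent code: octic + quartic resolvent algebras, own local
  image sampler, own saturation by residue characters, Mordell–Weil generator located in `Sel³`): `dim_𝔽₃ Sel^(3)(E/ℚ) = 3` on both.
* `h1 : ∃ x ∈ Ш[3], x ≠ 0, x ∉ 3Ш` — the plane cubic `C_η` of a basis element `η` of engine 1's `Sel³` (route-A stage A3,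
  `octic_a3a.gp` / `octic_a3bc.gp`: the obstruction algebra `A_ρ` split explicitly, `C_η ⊂ ℙ²` from the trace-zero coordinates,
  `Jac(C_η) ≅ E` over `ℚ` checked on `c₄, c₆`, `𝔽_p`-points at every good `5 ≤ p < 60`), MINIMISED and reduced to
  `C_min = λ·C_η(M·X)` (`M ∈ GL₃(ℚ)`, `λ ∈ ℚ×` displayed; identity re-verified exactly by the minimiser), whose algebraic `3`-Selmer
  SET is EMPTY on both second-descent engines (B. Creutz, Math. Comp. 83 (2014) §7, F-part: engine 1 `ninedesc.gp` r6.2 —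
  flex algebra handled factor-wise, `bnfcertify(F,1) = 1`, local images certified as supersets, `Jac = E` re-decided — ‖ engine 2
  `ninedesc_e2_et.py` r4.1, SageMath): `Sel^(3)(C_min/ℚ) = ∅`. By Creutz's Lemma 3.8 (the image of `Sel^(3)(C_η/ℚ)` in
  `Ш(E/ℚ)[9]` is `{D : 3D = [C_η]}`) this says NO `D ∈ Ш` has `3D = [C_η]`: so `[C_η] ≠ 0` and `[C_η] ∉ 3Ш` — in ANY rank, with NO
  Mordell–Weil datum (equivalently: `η ∉ 3·Sel^(9)(E/ℚ) ⊇ κ₃(E(ℚ)) = 3·κ₉(E(ℚ))`); a cubic on the Mordell–Weil line has a rational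
  point, is CONSISTENT under the second descent, and is never cited.
* `hr : r_an = 1`, `hq`/`hv : ord₃ #Ш_an = 2` — DISPLAYED (Cremona `allbsd`: rank-one analytic order `L′(E,1)/(Ω·Reg·∏c/#tors²)`
  to the table's precision = `9.000…`; the desk's rank-one analytic-order clause prices it, as on every rank-one record of the book).
NO torsion binder (`#E(ℚ)_tors ∈ {1, 2}` here anyway), NO pairing VALUE, NO Kato / Skinner–Urban / main conjecture, NO image or
reduction hypothesis at `3`. Ellipticity of the literal Cremona model is an instance binder (kernel-decidable, left displayed).
Documents: SEALED at filing (write-once) under `HOME/b2b-bsdres-x10/g57/docs-R1/` (`front/ d3f/ a3x/ cubx/ e1/ e2/`, `SHA256SUMS` —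
the 16 hex digits cited below are its prefixes —, `SOURCES.tsv` = producing kit job per file); kits `HOME/b2b-bsdres-x10/g57/kit/`
(`front57` `d3f57` `a3x57` `cubx57` `c9e157` `c9e257`, byte provenance in `KITS.md`); driver `gen57/r1sha9.py`; cell file X10-AUDIT.md §63.

References: J. W. S. Cassels 1962 (IV) [Cassels1962ArithmeticIV]; Cassels 1998 §1 [Cassels1998]; Silverman AEC Thm. X.4.2(a),
X.4.14 [SilvermanAEC2009]; B. Creutz, Math. Comp. 83 (2014) Thm. 7.2, Alg. 7.3 [Creutz2014]; R. L. Miller 2011 Def. 1.1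
[Miller2011LMS]; J. E. Cremona, tables [Cremona2006]; E. F. Schaefer – M. Stoll 2004 [SchaeferStoll2004];
T. Fisher – R. Newton 2014 (flex algebra / plane cubics of 3-coverings) [FisherNewton2014].
-/

set_option autoImplicit false

noncomputable section

open scoped Classical

open WeierstrassCurve Literature.NumberTheory.EllipticCurves
  Literature.NumberTheory.EllipticCurves.Rank1Residual
  Literature.NumberTheory.EllipticCurves.Rank1Residual.Typed

namespace Summit.BirchSwinnertonDyer.Rank1Residual.X10
/-! ### `463488bg1` -/

/-- **`BSD(E,3)` for `463488bg1`** (`N = 463488 = 2⁷·3·17·71`, multiplicative at `3`, `ρ̄_{E,3}` SURJECTIVE (Cremona `galrep`: no entry at `3`); Cremona's minimal model `[0, 1, 0, -231973406, -1359972438474]`;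
analytic rank `1` (Cremona generator `[2352074:1273611729:8]`), `#E(ℚ)_tors = 1`, `∏ c_ℓ = 6`, `#Ш_an = 9.00000000000000` so `ord₃ #Ш_an = 2`; book cell (3, X11b) RESIDUE on
referee A2's R1113 output 7c4a3c30d8 of 2026-08-30) from the Cassels–Tate pairing fact bsd.S18 (`hCT`, displayed), GZK, and the two two-engine inputs of the R1SHA9 certificate:
`hcard`: ENGINE 1 x11b `desc3lib.gp` front (kit j338341): `S = [2, 3, 17, 71]`, `Cl(A) = [12, [12]]`, `14` generators of `A(S,3)`, `dim H¹(ℚ,E[3];S) = 3`,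
**`dim Sel³(E/ℚ) = 3`**, mode `EXACT(bnfcertify1+3sat)` (PARI analytic-rank datum `[1, 6.46715117879397]`; MW `mw:rank(ellrank)>=1 pts=1 F(P) in <Sel> as [[2, 0, 0]]`) ‖ ENGINE 2 x10b `desc3full_e2.py` (kit j337862): `S = [2, 3, 17, 71]`,
`Cl(A) = [12, [12]]`, `bnfcertify(A,1) = 1`, `dim H¹_S = 3`, **`dim Sel³ = 3`**, mode `EXACT(bnfcertify1+3sat)`, Mordell–Weil rank in `Sel³` = 1, verdict `dimSha[3]=2`
⟹ **`#Sel³(E/ℚ) = 27`**. `h1`: line `eta011` = `η₂η₃` of `Sel³ = ⟨η₁,η₂,η₃⟩` (engine 1's basis; frame patch `JOB_LINES13` of `octic_a3a.gp`, opt-in, sha16 d2e9c14867e1686b) — stage-A3 cubic (kit j338785) minimised/reduced (`cubx57`, `M = [-215525549236260,55959283084038,-440768004929292;61359232293729,-15931376404846,125484827659355;1806943536100,-469156743652,3695352593922]`, `λ = 1/216`) to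
`C_min : 42x³ − 15x²y − 102x²w − 166xyw − 68xw² − 42y³ − 78y²w + 78yw² − 63w³ = 0`; second `3`-descent EMPTY on BOTH engines: E1 `ninedesc.gp r6.2` (kit j339074, seed 1, `S = [2, 3, 17, 71]`, flex field `F` = `t^9 - 204*t^7 - 2144*t^6 - 1962*t^5 + 100416*t^4 + 781588*t^3 + 1951200*t^2 - 2127183*t - 17441856` (disc -19468736537811902005248), `Cl(F) = [[]]`, `bnfcertify(F,1) = 1`, 17 generators of `F(S,3)`, completeness «R = 17 = unit ranks (+zeta) 5 + #S_F 12 + k_comp 0; residue-character rank = R; bnfcertify(1) = 1», affine system rank 10 < 11 with the right-hand side ⇒ NO solution ⇒ `Sel³(C_min/ℚ) = ∅` [EMPTY = 1; `Jac = E`: 1; 330.155 s; doc `c9_463488bg1_eta011.json` 1cb3d041f9914749]) ‖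
E2 `ninedesc_e2_et.py r4.3` (SageMath version 10.9; kit j338864, seed 2, `S = [2, 3, 17, 71]`, `F` disc -19468736537811902005248, `Cl(F) = [[]]`, proof_number_field = False, 17 generators, system rank 10 < 11 ⇒ EMPTY = True; 2.2 s; doc `c9e2_463488bg1_eta011.json` 14f3063d9a851ddc) ⟹ (Creutz Lemma 3.8) no `D ∈ Ш(E/ℚ)` with `3D = [C_η]`: **`[C_η] ≠ 0` in `Ш(E/ℚ)[3]` and `[C_η] ∉ 3·Ш(E/ℚ)`**.
Per pair; not a class theorem; books nothing. [cite: Creutz2014, Lemma 3.8, Thm. 7.2 and Alg. 7.3] [cite: Cassels1962ArithmeticIV] [cite: Miller2011LMS, Def. 1.1]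
[cite: SilvermanAEC2009, Thm X.4.2(a) and Thm. X.4.14] -/
theorem bsdp_r1sha9_e463488bg1 (hCT : exists_casselsTate_pairing (K := ℚ))
    (hGZK : rank_eq_analyticRank_of_analyticRank_le_one)
    (W : WeierstrassCurve ℚ) [W.IsElliptic] (hW : W = ⟨0, 1, 0, (-231973406), (-1359972438474)⟩)
    (hr : W.analyticRank = 1)
    (hcard : Nat.card (W.selmerGroup (3 : ℤ)) = 27)
    (h1 : ∃ x : W.sha, 3 • x = 0 ∧ x ≠ 0 ∧ ∀ z : W.sha, 3 • z ≠ x)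
    {q : ℚ} (hq : shaAn W = (q : ℂ)) (hv : padicValRat 3 q = 2) : BSDp W 3 := by
  subst hW
  exact bsdp_three_rankOne_of_card_selmerThree_of_oneNonDivisible hCT hGZK _ hr hcard h1 hq hv


end Summit.BirchSwinnertonDyer.Rank1Residual.X10

end
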